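import Summits.ValiantsHypothesis.ValiantsHypothesis.Theorems.KPlusLogSqLawTropicalSymmetricThreeFour
import Summits.ValiantsHypothesis.ValiantsHypothesis.Theorems.KPlusLogSqLawTropicalCensusRows

/-!
# Route «KPlusLogSqLaw» — the SYMMETRIC `(3,4)` tropical row from below: `T^single_sym(3,4) ≥ 15`, attained on the
# support `d = (0,1,4,13)` by an explicit symmetric design with sixteen uniquely dominant terms

HONEST FRAMING.  Helper file (seat val-sym-lift-p2 (g5), cell `pub-symmetroid`, 2026-08-26; `--supports` the `WeakLifting` item
stmt-ValiantsHypothesis-19561 as a helper, no closure claim; desk GO of record R1565 (ii), «floor half»).  A FIXED-FORMAT, FIXED-SUPPORT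
statement in the single-term-carrier model of the tree (`MatrixDescartes.Negative.IsDominant`: a chain vertex is carried by ONE
uniquely optimal Leibniz term), far inside the known regime of the cruxes; nothing here is about `TropicalB` / `WeakLifting` in their
windows, Conjecture B, the real census numeral of Door A at `(3,4)` (`PosRootLawAt 3 4 18`, OPEN, never asserted — the patchworking
corollary below gives `15` positive zeros on one support, BELOW the cell's real census value `18` of the format),
`MatrixDescartes` (stmt-ValiantsHypothesis-18050) or VP ≠ VNP.

STATEMENT.  The tree theorem `KPlusLogSqLaw.tropRow_three_four_symm_le` (p459728) bounds every sign-alternating chain of uniquely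
dominant terms of a SYMMETRIC `3 × 3` four-class dominance design by `n ≤ 18`, on every support.  This file proves the matching FLOOR
`15`: on `d = (0,1,4,13)` there is a symmetric design (symmetric integer valuations `v ≥ 0`, symmetric signs `ε ∈ {−1, 1}`: all
thirty-six incidences present, diagonal signs `(−,+,−,−) / (−,+,−,+) / (+,−,+,+)` by class, off-diagonal signs `+1`) with a chain of
SIXTEEN uniquely dominant terms at the integer slopes `−364 < −298 < ⋯ < 204` whose signs alternate — `15` alternations.  Hence no
bound of the `tropRow_three_four_symm_le` shape can be below `15` (`fifteen_le_of_symm_bound`, `not_symm_bound_fourteen`), already on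
this one support and already for bounds that also assume `|ε| ≤ 1` (`fifteen_le_on`); and, by the tree's symmetric patchworking
(`TropicalCensus.le_card_posRoots_patchMatrix`, `patchMatrix_isSymm`), some real symmetric `3 × 3` pencil on the support `(0,1,4,13)`
has at least `15` distinct positive zeros of its determinant (`fifteen_le_of_posRootLawOn`; free, below the census).
The chain, in the cell's letters (`T_k(a;b)` = transposition fixing `k` with class `a` on the fixed entry and `b` on the 2-cycle,
`D(λ₀λ₁λ₂)` = identity term): `T₀(0;0)⁺ T₀(1;0)⁻ T₁(0;1)⁺ T₁(1;1)⁻ T₀(2;0)⁺ D(210)⁻ T₀(2;1)⁺ T₂(0;2)⁻ T₂(1;2)⁺ T₂(2;2)⁻ T₀(3;1)⁺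
D(312)⁻ T₀(3;2)⁺ D(313)⁻ D(323)⁺ D(333)⁻` — these are ALL the uniquely dominant vertices of the design (checked outside the kernel by
two independent exact codes over all `3!·4³ = 384` terms; the kernel checks only what is stated).  The cell's one-code DP bound
(theory-2 g19, LAW-VS-KERNEL-TROPICAL-t2g19.md) says `15` is also the CEILING of the single-term symmetric row on every support; that
half is NOT claimed here — the kernel window for the symmetric single-term `(3,4)` row after this file is `[15, 18]`.

PROOF.  `decide` on explicit integer data through the tree's dual certificate `TropicalCensus.isDominant_of_scaledPotential` (scale
`S = 1`): per slope, integer potentials `u, w : Fin 3 → ℤ` tight on the three incidences of the chain term and strictly slack on the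
other thirty-three present incidences; strict monotonicity of the slopes; sign alternation of `termSign` (incl. `Equiv.Perm.sign`).
[design: theory-2 g19, HOME/pub-symmetroid-theory-2/rows/law-g19/tsym34/witness16_0-1-4-13.json (exact LP, margin 1, rational heights
with denominator 26), 2026-08-26; integer normalisation `v = 2417 − 26·h`, integer slopes inside the sixteen dominance intervals and
the potentials re-derived by this seat's independent exact checker exp/floor34.py; folklore-level certificate, no citation exists]
-/

-- `Summit.ValiantsHypothesis.ValiantsHypothesis.…` repeats a component by the D-0017 layout
-- (single-conjunct summit), which the `dupNamespace` linter flags; the name is mandated.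
set_option linter.dupNamespace false
set_option autoImplicit false

namespace Summit.ValiantsHypothesis.ValiantsHypothesis.Theorems.KPlusLogSqLaw

open Summit.ValiantsHypothesis.ValiantsHypothesis.Theorems.MatrixDescartes.Negative
open Summit.ValiantsHypothesis.ValiantsHypothesis.Theorems.LacunarySymmetroidMatrixDescartes
open Summit.ValiantsHypothesis.ValiantsHypothesis.Theorems.LacunarySymmetroidMatrixDescartes.TropicalCensus
open Finset

namespace SymmetricThreeFourFloor

/-- **The design.**  On the support `d = (0,1,4,13)`: a SYMMETRIC `3 × 3` four-class dominance design with signs in `{−1, 1}` and a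
chain of sixteen uniquely dominant terms at strictly increasing integer slopes with alternating signs (`15` alternations).
[theory-2 g19 witness16_0-1-4-13 (2026-08-26), integer certificate by this seat; kernel check by `decide` through
`TropicalCensus.isDominant_of_scaledPotential`] -/
theorem exists_chain :
    ∃ (v ε : Fin 3 → Fin 3 → Fin 4 → ℤ) (θ : Fin 16 → ℤ) (p : Fin 16 → Equiv.Perm (Fin 3) × (Fin 3 → Fin 4)),
      (∀ i j l, v i j l = v j i l) ∧ (∀ i j l, ε i j l = ε j i l) ∧ (∀ i j l, (ε i j l).natAbs ≤ 1) ∧ StrictMono θ ∧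
      (∀ k, IsDominant ![0, 1, 4, 13] v ε (θ k) (p k)) ∧
      (∀ k : Fin 15, termSign ε (p k.castSucc) * termSign ε (p k.succ) < 0) := by
  let D : Fin 4 → ℕ := ![0, 1, 4, 13]
  let V : Fin 3 → Fin 3 → Fin 4 → ℤ := ![![![2417, 2054, 1511, 2404], ![1260, 1027, 783, 2417], ![1429, 1066, 1108, 2417]], ![![1260, 1027, 783, 2417], ![181, 0, 575, 2404], ![246, 195, 666, 2417]], ![![1429, 1066, 1108, 2417], ![246, 195, 666, 2417], ![415, 494, 835, 2404]]]
  let E : Fin 3 → Fin 3 → Fin 4 → ℤ := ![![![(-1 : ℤ), 1, (-1 : ℤ), (-1 : ℤ)], ![1, 1, 1, 1], ![1, 1, 1, 1]], ![![1, 1, 1, 1], ![(-1 : ℤ), 1, (-1 : ℤ), 1], ![1, 1, 1, 1]], ![![1, 1, 1, 1], ![1, 1, 1, 1], ![1, (-1 : ℤ), 1, 1]]]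
  let Th : Fin 16 → ℤ := ![(-364 : ℤ), (-298 : ℤ), (-207 : ℤ), (-155 : ℤ), (-103 : ℤ), (-51 : ℤ), 7, 59, 96, 122, 140, 157, 172, 185, 197, 204]
  let Sg : Fin 16 → Equiv.Perm (Fin 3) := ![(Equiv.swap (1 : Fin 3) 2 : Equiv.Perm (Fin 3)), (Equiv.swap (1 : Fin 3) 2 : Equiv.Perm (Fin 3)), (Equiv.swap (0 : Fin 3) 2 : Equiv.Perm (Fin 3)), (Equiv.swap (0 : Fin 3) 2 : Equiv.Perm (Fin 3)), (Equiv.swap (1 : Fin 3) 2 : Equiv.Perm (Fin 3)), (1 : Equiv.Perm (Fin 3)), (Equiv.swap (1 : Fin 3) 2 : Equiv.Perm (Fin 3)), (Equiv.swap (0 : Fin 3) 1 : Equiv.Perm (Fin 3)), (Equiv.swap (0 : Fin 3) 1 : Equiv.Perm (Fin 3)), (Equiv.swap (0 : Fin 3) 1 : Equiv.Perm (Fin 3)), (Equiv.swap (1 : Fin 3) 2 : Equiv.Perm (Fin 3)), (1 : Equiv.Perm (Fin 3)), (Equiv.swap (1 : Fin 3) 2 : Equiv.Perm (Fin 3)),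 (1 : Equiv.Perm (Fin 3)), (1 : Equiv.Perm (Fin 3)), (1 : Equiv.Perm (Fin 3))]
  let Cl : Fin 16 → Fin 3 → Fin 4 := ![![(0 : Fin 4), (0 : Fin 4), (0 : Fin 4)], ![(1 : Fin 4), (0 : Fin 4), (0 : Fin 4)], ![(1 : Fin 4), (0 : Fin 4), (1 : Fin 4)], ![(1 : Fin 4), (1 : Fin 4), (1 : Fin 4)], ![(2 : Fin 4), (0 : Fin 4), (0 : Fin 4)], ![(2 : Fin 4), (1 : Fin 4), (0 : Fin 4)], ![(2 : Fin 4), (1 : Fin 4), (1 : Fin 4)], ![(2 : Fin 4), (2 : Fin 4), (0 : Fin 4)], ![(2 : Fin 4), (2 : Fin 4), (1 : Fin 4)], ![(2 : Fin 4), (2 : Fin 4), (2 : Fin 4)], ![(3 : Fin 4), (1 : Fin 4), (1 : Fin 4)], ![(3 : Fin 4), (1 : Fin 4), (2 : Fin 4)], ![(3 : Fin 4), (2 : Fin 4), (2 : Fin 4)], ![(3 : Fin 4), (1 : Fin 4), (3 : Fin 4)], ![(3 : Fin 4), (2 : Fin 4), (3 : Fin 4)], ![(3 : Fin 4), (3 :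 Fin 4), (3 : Fin 4)]]
  let U : Fin 16 → Fin 3 → ℤ := ![![0, 1158, 990], ![0, 1093, 989], ![0, 1028, 964], ![0, 976, 886], ![0, 899, 755], ![0, 769, 599], ![0, 729, 503], ![0, 692, 412], ![0, 601, 301], ![0, 498, 223], ![0, 362, 143], ![0, 209, 15], ![0, 151, 0], ![0, 74, 0], ![0, 0, 0], ![0, 0, 0]]
  let W : Fin 16 → Fin 3 → ℤ := ![![(-2417 : ℤ), (-1236 : ℤ), (-1404 : ℤ)], ![(-2352 : ℤ), (-1235 : ℤ), (-1339 : ℤ)], ![(-2237 : ℤ), (-1209 : ℤ), (-1273 : ℤ)], ![(-2107 : ℤ), (-1131 : ℤ), (-1221 : ℤ)], ![(-1923 : ℤ), (-1001 : ℤ), (-1145 : ℤ)], ![(-1715 : ℤ), (-820 : ℤ), (-1014 : ℤ)], ![(-1483 : ℤ), (-691 : ℤ), (-917 : ℤ)], ![(-1239 : ℤ), (-547 : ℤ), (-827 : ℤ)], ![(-1000 : ℤ), (-399 : ℤ), (-699 : ℤ)], ![(-793 : ℤ), (-295 : ℤ), (-570 : ℤ)], ![(-584 : ℤ), (-198 :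 ℤ), (-417 : ℤ)], ![(-363 : ℤ), (-52 : ℤ), (-222 : ℤ)], ![(-168 : ℤ), 22, (-129 : ℤ)], ![1, 111, 1], ![157, 213, 157], ![248, 248, 248]]
  have hv : ∀ i j l, V i j l = V j i l := by decide
  have hεs : ∀ i j l, E i j l = E j i l := by decide
  have hε : ∀ i j l, (E i j l).natAbs ≤ 1 := by decide
  have hθ : StrictMono Th := by rw [Fin.strictMono_iff_lt_succ]; decide
  have hp : ∀ k i, E (Sg k i) i (Cl k i) ≠ 0 := by decide
  have ht : ∀ k i, U k (Sg k i) + W k i = 1 * (Th k * (D (Cl k i) : ℤ) - V (Sg k i) i (Cl k i)) := by decide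
  have hs : ∀ k a b l, E a b l ≠ 0 → (Sg k b ≠ a ∨ Cl k b ≠ l) → 1 * (Th k * (D l : ℤ) - V a b l) < U k a + W k b := by decide
  have hdom : ∀ k, IsDominant D V E (Th k) (Sg k, Cl k) := fun k =>
    isDominant_of_scaledPotential D V E (Th k) (Sg k) (Cl k) 1 (by norm_num) (U k) (W k) (hp k) (ht k) (hs k)
  have halt : ∀ k : Fin 15, termSign E ((fun k => (Sg k, Cl k)) k.castSucc) * termSign E ((fun k => (Sg k, Cl k)) k.succ) < 0 := by
    decide
  exact ⟨V, E, Th, fun k => (Sg k, Cl k), hv, hεs, hε, hθ, hdom, halt⟩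

/-- **`T^single_sym(3,4; (0,1,4,13)) ≥ 15` — support-level floor.**  Every `B` that bounds the alternation count `n` of all chains of
uniquely dominant terms of all SYMMETRIC designs with signs in `{−1,0,1}` on the support `(0,1,4,13)` satisfies `15 ≤ B`.
[from `exists_chain`] -/
theorem fifteen_le_on {B : ℕ}
    (h : ∀ (v ε : Fin 3 → Fin 3 → Fin 4 → ℤ), (∀ i j l, v i j l = v j i l) → (∀ i j l, ε i j l = ε j i l) →
      (∀ i j l, (ε i j l).natAbs ≤ 1) →
      ∀ (n : ℕ) (θ : Fin (n + 1) → ℤ) (p : Fin (n + 1) → Equiv.Perm (Fin 3) × (Fin 3 → Fin 4)),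
      StrictMono θ → (∀ k, IsDominant ![0, 1, 4, 13] v ε (θ k) (p k)) →
      (∀ k : Fin n, termSign ε (p k.castSucc) * termSign ε (p k.succ) < 0) → n ≤ B) : 15 ≤ B := by
  obtain ⟨v, ε, θ, p, hv, hεs, hε, hθ, hdom, halt⟩ := exists_chain
  exact h v ε hv hεs hε 15 θ p hθ hdom halt

end SymmetricThreeFourFloor

open SymmetricThreeFourFloor

/-- **`T^single_sym(3,4) ≥ 15` — format-level floor in the exact shape of `tropRow_three_four_symm_le`.**  Every `B` bounding the
alternation count of all chains of uniquely dominant terms of all symmetric `3 × 3` four-class designs on all supports (the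
hypotheses of `tropRow_three_four_symm_le`, with `18` replaced by `B`) satisfies `15 ≤ B`: the tree ceiling `18` (p459728) cannot be
sharpened below `15`.  (`fifteen_le_of_symm_bound tropRow_three_four_symm_le : 15 ≤ 18` elaborates — the shapes match.)
[from `fifteen_le_on`] -/
theorem fifteen_le_of_symm_bound {B : ℕ}
    (h : ∀ (d : Fin 4 → ℕ) (v ε : Fin 3 → Fin 3 → Fin 4 → ℤ), (∀ i j l, v i j l = v j i l) → (∀ i j l, ε i j l = ε j i l) →
      ∀ (n : ℕ) (θ : Fin (n + 1) → ℤ) (p : Fin (n + 1) → Equiv.Perm (Fin 3) × (Fin 3 → Fin 4)),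
      StrictMono θ → (∀ k, IsDominant d v ε (θ k) (p k)) →
      (∀ k : Fin n, termSign ε (p k.castSucc) * termSign ε (p k.succ) < 0) → n ≤ B) : 15 ≤ B :=
  fifteen_le_on fun v ε hv hεs _ n θ p hθ hdom halt => h _ v ε hv hεs n θ p hθ hdom halt

example : 15 ≤ 18 := fifteen_le_of_symm_bound tropRow_three_four_symm_le

/-- **No `≤ 14` version of `tropRow_three_four_symm_le`.**  The symmetric single-term `(3,4)` tropical row is at least `15`; with
the tree ceiling the kernel window is `[15, 18]`. [from `fifteen_le_of_symm_bound`] -/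
theorem not_symm_bound_fourteen :
    ¬ (∀ (d : Fin 4 → ℕ) (v ε : Fin 3 → Fin 3 → Fin 4 → ℤ), (∀ i j l, v i j l = v j i l) → (∀ i j l, ε i j l = ε j i l) →
      ∀ (n : ℕ) (θ : Fin (n + 1) → ℤ) (p : Fin (n + 1) → Equiv.Perm (Fin 3) × (Fin 3 → Fin 4)),
      StrictMono θ → (∀ k, IsDominant d v ε (θ k) (p k)) →
      (∀ k : Fin n, termSign ε (p k.castSucc) * termSign ε (p k.succ) < 0) → n ≤ 14) :=
  fun h => absurd (fifteen_le_of_symm_bound h) (by norm_num)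

/-- **Patchworking corollary (free, below the census): `ζ₊(3,4; (0,1,4,13)) ≥ 15` by a SYMMETRIC Viro pencil.**  Every support-level
row `PosRootLawOn 3 4 B (0,1,4,13)` has `15 ≤ B`: the patchworked pencil of the design of `exists_chain` is symmetric
(`patchMatrix_isSymm`) and has at least `15` distinct positive zeros (`le_card_posRoots_patchMatrix`).  The cell's real census of
record at `(3,4)` is `18` (on other supports, by non-patchwork pencils); nothing here bears on `PosRootLawAt 3 4 18`.
[from `exists_chain` + tree patchworking] -/
theorem fifteen_le_of_posRootLawOn {B : ℕ} (h : PosRootLawOn 3 4 B ![0, 1, 4, 13]) : 15 ≤ B := by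
  obtain ⟨v, ε, θ, p, hv, hεs, hε, hθ, hdom, halt⟩ := exists_chain
  exact (le_card_posRoots_patchMatrix _ v ε hε θ hθ p hdom halt).trans (h _ fun l => patchMatrix_isSymm _ v ε hv hεs l)

/-- **`¬ PosRootLawOn 3 4 14 (0,1,4,13)`**: some real symmetric `3 × 3` pencil on the support `(0,1,4,13)` has at least `15` distinct
positive zeros of its determinant. [from `fifteen_le_of_posRootLawOn`] -/
theorem not_posRootLawOn_three_four_fourteen : ¬ PosRootLawOn 3 4 14 ![0, 1, 4, 13] :=
  fun h => absurd (fifteen_le_of_posRootLawOn h) (by norm_num)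

end Summit.ValiantsHypothesis.ValiantsHypothesis.Theorems.KPlusLogSqLaw
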